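import Summits.BirchSwinnertonDyer.BirchSwinnertonDyer.Theorems.TeichmullerTwistDescentCellsOfKatoTransfer
import Summits.BirchSwinnertonDyer.BirchSwinnertonDyer.Theorems.AdditiveKolyvaginRoadManinFrameResidueProperRAuxPrime
import Summits.BirchSwinnertonDyer.BirchSwinnertonDyer.Theorems.TeichmullerTwistDescentCellsByNameFromKato
import Summits.BirchSwinnertonDyer.BirchSwinnertonDyer.Theorems.TeichmullerTwistDescentAssembly
import Summits.BirchSwinnertonDyer.BirchSwinnertonDyer.Theorems.TeichmullerTwistDescentWeilTypeManinGlue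
import Summits.BirchSwinnertonDyer.BirchSwinnertonDyer.Theorems.TeichmullerTwistDescentPrincipalSeriesOptimalManinUnitOfCells
import Summits.BirchSwinnertonDyer.BirchSwinnertonDyer.Theorems.TeichmullerTwistDescentSupercuspidalOptimalManinUnitFiveSevenOfCell
import HarnessLib

/-!
# Route `TeichmullerTwistDescent`: the WHOLE Manin side — PSMU (22638), SCMU57 (22639), CORNER (23883), LOW (23884),
# WILD (24306), TAME (24307), GE11 (23885) — and the rung W-ALL/2.p>=5.r1, GRANTED ONLY modularity and Kato's fact F″
# (equivalently: ONLY the route's two REGISTERED bundles); NO Ihara lemma, NO witness hypothesis — `--supports`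

Cell `pub/bsd-wall` (D-0145 line route-BirchSwinnertonDyer-TeichmullerTwistDescent, OPEN rev 5), seat `bsd-line-ttd-p2`
(prover 2/2, g3), item of record PSMU (stmt-BirchSwinnertonDyer-22638). THEOREMS ONLY (no definition, no named fact, no
`sorry`); every theorem is `proof.conditional` on cite-only PRINTED facts; nothing is closed by name; BSD is not proved.

WHAT THIS FILE DOES. It plugs the cell's PROVED transfer witness
`AuxPrime.transferWitness` (seat bsd-wall-manin-p1 g7, `…ManinFrameResidueProperRAuxPrime.lean`, 2026-08-28T02:02Z:
for `p ∈ {5,7}`, `V₀` globally minimal with `E[p]` irreducible there IS a prime `q ≠ 2, p`, `q ∤ N(V₀)`, `q*` a non-square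
mod `p`, `p ∤ (q−1)((q+1)² − a_q(V₀)²)` — Chebotarev in `ℚ(E[4p])` + subgroups of `GL₂(𝔽_p)`, all PROVED) into the
Ihara-free closers of seat bsd-line-edix-p2 g3 (`TeichmullerTwistDescentCellsOfKatoTransfer.lean`:
`not_dvd_c_of_kato_of_transferWitness`, whose hypothesis `hW` is that witness VERBATIM; L-TWIST at the witness prime by
the transfer of cycles `LTwistTransfer.lTwist_of_transfer`, seat edix-p3 g3 — Road A′). RESULT:

* `not_dvd_c_of_kato` — **Manin's `p`-part at EVERY lattice-optimal datum of EVERY curve additive at `p ≥ 5` with `E[p]`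
  irreducible, GRANTED `exists_isNewformOf` and F″ ONLY** (was: + Ihara³, this seat's g2 `not_dvd_c_of_kato_of_iharaSq`;
  or + L-TWIST / + hW″).
* the SIX Manin decls of the route by name from {`exists_isNewformOf`, F″}: `principalSeriesOptimalManinUnit_of_kato`,
  `supercuspidalOptimalManinUnitFiveSeven_of_kato`, `kummerCornerTorsionOptimalManinUnit_of_kato`,
  `supersingularTorsionOptimalManinUnitFive_of_kato`, `kummerCornerWildManinUnit_of_kato`,
  `kummerCornerTameManinUnit_of_kato`; and from the route's two REGISTERED hypothesis-only bundles
  `KatoNeronAndCremonaFacts` (23789: F″ inside) and `PublishedInputsAdditiveKoly` (20137: modularity inside):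
  `…_of_pubBundles` ×6 — the shape in which a twin «KatoNeronAndCremonaFacts → PublishedInputsAdditiveKoly → X» closes
  by `exact`; `maninSide_of_pubBundles` — all SEVEN (with GE11, which needs `KatoNeronAndCremonaFacts` alone) at once.
* `wAllExclAdditiveFiveLeRankOne_of_akr_of_pubBundles` — **the rung `Summit.BirchSwinnertonDyer.WAllExclAdditiveFiveLeRankOne`
  (W-ALL/2.p>=5.r1) from REGISTERED ROUTE ITEMS ONLY: the three AKR-shared open cruxes `KolyvaginPrimitiveAdditive`
  (21400), `RankZeroAdditive` (20133), `OffSharpRankOneAdditive` (20134) and the three hypothesis-only bundles (20137,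
  22230, 23789)** — via the landed assembly (22641); `…_of_closes_of_pubBundles` — the same through the route's own
  deciding theorem `closes` with all twelve hypotheses fed. Supersedes this seat's `…_of_iharaSq` forms (p595669).

HONEST STATUS (numbers): cite-only printed inputs of the TTD Manin side = 2 (F″ =
`kato_neron_isIntegral_twistedSymbolSum_of_additive_five_le`, XL, referee-flagged; modularity = `exists_isNewformOf`,
BCDT), both INSIDE registered bundles; Ihara³ and every witness hypothesis are GONE from the cone. The six Manin items
stay open BY NAME only because their statements are unconditional while the bundles are hypothesis-only items; the
route's live residual is the Kolyvagin side {21400, 20133, 20134}. BSD is not proved by this; no W-ALL class theorem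
is proved by this. [cite: Kato2004Asterisque, (8.1.3) (p. 180), Thm. 9.7 (p. 189)] [cite: KimNakamura2020, Cor. 2.4]
[cite: KostersPannekoek2017, Thm. 1 and Cor. 2] [cite: Stevens1989, Lemma (5.2) p. 96, Lemma (5.4) p. 97]
[cite: Ribet1990, §3] [cite: TateGCFT1967, §2.4 (Tchebotarev density theorem)] [cite: BCDTJAMS2001, Thm. A]
-/

set_option autoImplicit false
-- single-conjunct summit: `Summit.BirchSwinnertonDyer.BirchSwinnertonDyer.…` repeats the name by design
set_option linter.dupNamespace false

noncomputable section

open scoped Classical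

open WeierstrassCurve Literature.NumberTheory.EllipticCurves Literature.NumberTheory.EllipticCurves.ModularForms
  Literature.NumberTheory.EllipticCurves.Rank1Residual
  Summit.BirchSwinnertonDyer.BirchSwinnertonDyer.Theses.TeichmullerTwistDescent
  Summit.BirchSwinnertonDyer.BirchSwinnertonDyer.Theorems

namespace Summit.BirchSwinnertonDyer.BirchSwinnertonDyer.Theorems.TeichmullerTwistDescent

/-! ### §1 Manin's `p`-part at every lattice-optimal datum from modularity and F″ alone -/

/-- **Manin's `p`-part at EVERY lattice-optimal datum, GRANTED modularity and Kato's fact F″ ONLY.** For `W/ℚ` globally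
minimal, additive at a prime `p ≥ 5` with `E[p]` irreducible, and `D` a LATTICE-OPTIMAL parametrisation datum of `W`
(`Λ_W = c·Λ_f`) at any level: `p ∤ c(D)`. This is edix-p2's `not_dvd_c_of_kato_of_transferWitness` (p > 7: tame-twist
lever; p ∈ {5,7} off the Kosters–Pannekoek exception: the `p ∈ {5,7}` lever; on it: auxiliary unit twist + TORS-TWIST +
L-TWIST by the TRANSFER of cycles at a non-level-raising auxiliary prime) with its witness hypothesis `hW` DISCHARGED by
manin-p1's `AuxPrime.transferWitness` (Chebotarev, PROVED). No Ihara lemma anywhere in the cone. CONDITIONAL on the two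
cite-only printed facts `hnf`, `hK`; nothing closed; BSD is not proved by this.
[cite: Kato2004Asterisque, (8.1.3) (p. 180), Thm. 9.7 (p. 189)] [cite: KostersPannekoek2017, Thm. 1 and Cor. 2]
[cite: Stevens1989, Lemma (5.4) p. 97] [cite: Ribet1990, §3] [cite: TateGCFT1967, §2.4 (Tchebotarev density theorem)] -/
theorem not_dvd_c_of_kato (hnf : exists_isNewformOf)
    (hK : kato_neron_isIntegral_twistedSymbolSum_of_additive_five_le)
    (W : WeierstrassCurve ℚ) [W.IsElliptic] [W.IsGloballyMinimal] (p : ℕ) [Fact p.Prime]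
    {N : ℕ} [NeZero N] (D : ModularParametrizationData W N)
    (hp5 : 5 ≤ p) (hadd : Addv W p) (hirr : Irr W p)
    (hlat : ∀ z ∈ D.L.lattice, ∃ w ∈ periodLattice D.f, z = D.c * w) :
    ¬ (p : ℤ) ∣ D.c :=
  not_dvd_c_of_kato_of_transferWitness hnf hK AuxPrime.transferWitness W p D hp5 hadd hirr hlat

/-! ### §2 The six Manin decls of the route BY NAME from {modularity, F″} -/

/-- **PSMU (stmt-BirchSwinnertonDyer-22638) GRANTED modularity and F″ only.** Its Weil-type binders are idle.
CONDITIONAL; the item is not closed by this; BSD is not proved by this. [cite: Kato2004Asterisque, Thm. 9.7 (p. 189)]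
[cite: TateGCFT1967, §2.4 (Tchebotarev density theorem)] -/
theorem principalSeriesOptimalManinUnit_of_kato (hnf : exists_isNewformOf)
    (hK : kato_neron_isIntegral_twistedSymbolSum_of_additive_five_le) : PrincipalSeriesOptimalManinUnit :=
  principalSeriesOptimalManinUnit_of_kato_of_transferWitness hnf hK AuxPrime.transferWitness

/-- **SCMU57 (stmt-BirchSwinnertonDyer-22639) GRANTED modularity and F″ only.** CONDITIONAL; the item is not closed by
this; BSD is not proved by this. [cite: Kato2004Asterisque, Thm. 9.7 (p. 189)]
[cite: TateGCFT1967, §2.4 (Tchebotarev density theorem)] -/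
theorem supercuspidalOptimalManinUnitFiveSeven_of_kato (hnf : exists_isNewformOf)
    (hK : kato_neron_isIntegral_twistedSymbolSum_of_additive_five_le) : SupercuspidalOptimalManinUnitFiveSeven :=
  supercuspidalOptimalManinUnitFiveSeven_of_kato_of_transferWitness hnf hK AuxPrime.transferWitness

/-- **CORNER (stmt-BirchSwinnertonDyer-23883) GRANTED modularity and F″ only** — the Kosters–Pannekoek corner III@5 / II@7
WITH a `ℚ_p`-rational point of order `p`, reached by Kato + unit twist + transfer, no Ihara lemma. CONDITIONAL; the item
is not closed by this; BSD is not proved by this. [cite: Kato2004Asterisque, Thm. 9.7 (p. 189)]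
[cite: KostersPannekoek2017, Cor. 2] [cite: TateGCFT1967, §2.4 (Tchebotarev density theorem)] -/
theorem kummerCornerTorsionOptimalManinUnit_of_kato (hnf : exists_isNewformOf)
    (hK : kato_neron_isIntegral_twistedSymbolSum_of_additive_five_le) : KummerCornerTorsionOptimalManinUnit :=
  kummerCornerTorsionOptimalManinUnit_of_kato_of_transferWitness hnf hK AuxPrime.transferWitness

/-- **LOW (stmt-BirchSwinnertonDyer-23884) GRANTED modularity and F″ only** (II@5, potentially supersingular, with a
`ℚ_5`-rational point of order 5). CONDITIONAL; the item is not closed by this; BSD is not proved by this.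
[cite: Kato2004Asterisque, Thm. 9.7 (p. 189)] [cite: KostersPannekoek2017, Cor. 2]
[cite: TateGCFT1967, §2.4 (Tchebotarev density theorem)] -/
theorem supersingularTorsionOptimalManinUnitFive_of_kato (hnf : exists_isNewformOf)
    (hK : kato_neron_isIntegral_twistedSymbolSum_of_additive_five_le) : SupersingularTorsionOptimalManinUnitFive :=
  supersingularTorsionOptimalManinUnitFive_of_kato_of_transferWitness hnf hK AuxPrime.transferWitness

/-- **WILD `KummerCornerWildManinUnit` (stmt-BirchSwinnertonDyer-24306) GRANTED modularity and F″ only** — the wildness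
predicate, (G)-ordinarity and the torsion binder are idle: `not_dvd_c_of_kato` at the cell's `p ∈ {5,7}`. CONDITIONAL;
the item is not closed by this; BSD is not proved by this. [cite: Kato2004Asterisque, Thm. 9.7 (p. 189)]
[cite: TateGCFT1967, §2.4 (Tchebotarev density theorem)] -/
theorem kummerCornerWildManinUnit_of_kato (hnf : exists_isNewformOf)
    (hK : kato_neron_isIntegral_twistedSymbolSum_of_additive_five_le) : KummerCornerWildManinUnit := by
  intro W _ _ p _ _ D hcell hadd hirr _ _ _ hlat
  exact not_dvd_c_of_kato hnf hK W p D (by rcases hcell with ⟨rfl, -⟩ | ⟨rfl, -⟩ <;> norm_num) hadd hirr hlat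

/-- **TAME `KummerCornerTameManinUnit` (stmt-BirchSwinnertonDyer-24307) GRANTED modularity and F″ only** — the tame-split
predicate is idle likewise. CONDITIONAL; the item is not closed by this; BSD is not proved by this.
[cite: Kato2004Asterisque, Thm. 9.7 (p. 189)] [cite: TateGCFT1967, §2.4 (Tchebotarev density theorem)] -/
theorem kummerCornerTameManinUnit_of_kato (hnf : exists_isNewformOf)
    (hK : kato_neron_isIntegral_twistedSymbolSum_of_additive_five_le) : KummerCornerTameManinUnit := by
  intro W _ _ p _ _ D hcell hadd hirr _ _ _ hlat
  exact not_dvd_c_of_kato hnf hK W p D (by rcases hcell with ⟨rfl, -⟩ | ⟨rfl, -⟩ <;> norm_num) hadd hirr hlat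

/-! ### §3 The same from the route's two REGISTERED bundles (twin shape), and all seven at once -/

/-- **PSMU from `KatoNeronAndCremonaFacts` (23789) and `PublishedInputsAdditiveKoly` (20137) ONLY** — a twin
«KatoNeronAndCremonaFacts → PublishedInputsAdditiveKoly → PrincipalSeriesOptimalManinUnit» closes by `exact` this.
CONDITIONAL (hypothesis-only bundles); BSD is not proved by this. [cite: Kato2004Asterisque, Thm. 9.7 (p. 189)] -/
theorem principalSeriesOptimalManinUnit_of_pubBundles (hKC : KatoNeronAndCremonaFacts)
    (hP : PublishedInputsAdditiveKoly) : PrincipalSeriesOptimalManinUnit :=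
  principalSeriesOptimalManinUnit_of_kato hP.2.2.2.2.2.1 hKC.1

/-- **SCMU57 from the two registered bundles only.** CONDITIONAL; BSD is not proved by this.
[cite: Kato2004Asterisque, Thm. 9.7 (p. 189)] -/
theorem supercuspidalOptimalManinUnitFiveSeven_of_pubBundles (hKC : KatoNeronAndCremonaFacts)
    (hP : PublishedInputsAdditiveKoly) : SupercuspidalOptimalManinUnitFiveSeven :=
  supercuspidalOptimalManinUnitFiveSeven_of_kato hP.2.2.2.2.2.1 hKC.1

/-- **CORNER from the two registered bundles only.** CONDITIONAL; BSD is not proved by this.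
[cite: Kato2004Asterisque, Thm. 9.7 (p. 189)] -/
theorem kummerCornerTorsionOptimalManinUnit_of_pubBundles (hKC : KatoNeronAndCremonaFacts)
    (hP : PublishedInputsAdditiveKoly) : KummerCornerTorsionOptimalManinUnit :=
  kummerCornerTorsionOptimalManinUnit_of_kato hP.2.2.2.2.2.1 hKC.1

/-- **LOW from the two registered bundles only.** CONDITIONAL; BSD is not proved by this.
[cite: Kato2004Asterisque, Thm. 9.7 (p. 189)] -/
theorem supersingularTorsionOptimalManinUnitFive_of_pubBundles (hKC : KatoNeronAndCremonaFacts)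
    (hP : PublishedInputsAdditiveKoly) : SupersingularTorsionOptimalManinUnitFive :=
  supersingularTorsionOptimalManinUnitFive_of_kato hP.2.2.2.2.2.1 hKC.1

/-- **WILD from the two registered bundles only.** CONDITIONAL; BSD is not proved by this.
[cite: Kato2004Asterisque, Thm. 9.7 (p. 189)] -/
theorem kummerCornerWildManinUnit_of_pubBundles (hKC : KatoNeronAndCremonaFacts)
    (hP : PublishedInputsAdditiveKoly) : KummerCornerWildManinUnit :=
  kummerCornerWildManinUnit_of_kato hP.2.2.2.2.2.1 hKC.1

/-- **TAME from the two registered bundles only.** CONDITIONAL; BSD is not proved by this.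
[cite: Kato2004Asterisque, Thm. 9.7 (p. 189)] -/
theorem kummerCornerTameManinUnit_of_pubBundles (hKC : KatoNeronAndCremonaFacts)
    (hP : PublishedInputsAdditiveKoly) : KummerCornerTameManinUnit :=
  kummerCornerTameManinUnit_of_kato hP.2.2.2.2.2.1 hKC.1

/-- **All SEVEN Manin-side declarations of the route — PSMU, SCMU57, CORNER, LOW, WILD, TAME, GE11 — from the two
REGISTERED bundles `KatoNeronAndCremonaFacts` and `PublishedInputsAdditiveKoly` ONLY** (GE11 from the first alone,
`ordinaryLowValuationOptimalManinUnitGeEleven_of_katoNeronAndCremonaFacts`). No Ihara lemma, no witness. CONDITIONAL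
(hypothesis-only bundles); nothing closed; BSD is not proved by this. [cite: Kato2004Asterisque, (8.1.3) (p. 180), Thm. 9.7 (p. 189)]
[cite: TateGCFT1967, §2.4 (Tchebotarev density theorem)] -/
theorem maninSide_of_pubBundles (hKC : KatoNeronAndCremonaFacts) (hP : PublishedInputsAdditiveKoly) :
    PrincipalSeriesOptimalManinUnit ∧ SupercuspidalOptimalManinUnitFiveSeven ∧
      KummerCornerTorsionOptimalManinUnit ∧ SupersingularTorsionOptimalManinUnitFive ∧
      KummerCornerWildManinUnit ∧ KummerCornerTameManinUnit ∧ OrdinaryLowValuationOptimalManinUnitGeEleven :=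
  ⟨principalSeriesOptimalManinUnit_of_pubBundles hKC hP, supercuspidalOptimalManinUnitFiveSeven_of_pubBundles hKC hP,
    kummerCornerTorsionOptimalManinUnit_of_pubBundles hKC hP, supersingularTorsionOptimalManinUnitFive_of_pubBundles hKC hP,
    kummerCornerWildManinUnit_of_pubBundles hKC hP, kummerCornerTameManinUnit_of_pubBundles hKC hP,
    ordinaryLowValuationOptimalManinUnitGeEleven_of_katoNeronAndCremonaFacts hKC⟩

/-! ### §4 The rung W-ALL/2.p>=5.r1 from REGISTERED ROUTE ITEMS ONLY -/

/-- **The rung `WAllExclAdditiveFiveLeRankOne` (W-ALL/2.p>=5.r1) GRANTED ONLY registered items of the route: the three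
AKR-shared open cruxes `KolyvaginPrimitiveAdditive` (21400), `RankZeroAdditive` (20133), `OffSharpRankOneAdditive` (20134)
and the three hypothesis-only bundles `PublishedInputsAdditiveKoly` (20137), `PublishedManinFacts` (22230),
`KatoNeronAndCremonaFacts` (23789)** — through the landed assembly `assembly_proof` (22641), PSMU / SCMU57 from §3, G-WT by
its landed proof. No unregistered hypothesis. So the route's live residual is exactly the Kolyvagin side {21400, 20133,
20134}; its Manin side costs print (inside the bundles) only. CONDITIONAL; no item is closed by this; BSD is not proved
and no W-ALL class theorem is proved by this. [cite: Kato2004Asterisque, (8.1.3) (p. 180), Thm. 9.7 (p. 189)]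
[cite: WZhang2014, Thm. 1.1 (shape of the Kolyvagin-side cruxes)] -/
theorem wAllExclAdditiveFiveLeRankOne_of_akr_of_pubBundles
    (h₁ : KolyvaginPrimitiveAdditive) (h₀ : RankZeroAdditive) (hoff : OffSharpRankOneAdditive)
    (hP : PublishedInputsAdditiveKoly) (hF : PublishedManinFacts) (hKC : KatoNeronAndCremonaFacts) :
    Summit.BirchSwinnertonDyer.WAllExclAdditiveFiveLeRankOne :=
  TeichmullerTwistDescentAssembly.assembly_proof
    (principalSeriesOptimalManinUnit_of_pubBundles hKC hP) (supercuspidalOptimalManinUnitFiveSeven_of_pubBundles hKC hP)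
    WeilTypeManinGlue.weilTypeManinGlue_proof h₁ h₀ hoff hP hF

/-- **The same rung through the route's own deciding theorem `closes`** (rev 5: twelve hypotheses, USES EVERY ITEM):
CORNER, LOW, GE11 from the bundles (§3), the closed twins (23886, 23887) and glue (22640) by their landed `_proof`s, the AKR
cruxes and the bundles as hypotheses — one kernel-checked term: W-ALL/2.p>=5.r1 ⟸ {21400, 20133, 20134} ∪ {20137, 22230,
23789}, nothing else. CONDITIONAL; no item is closed by this; BSD is not proved by this.
[cite: Kato2004Asterisque, (8.1.3) (p. 180), Thm. 9.7 (p. 189)] -/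
theorem wAllExclAdditiveFiveLeRankOne_of_closes_of_pubBundles
    (h₁ : KolyvaginPrimitiveAdditive) (h₀ : RankZeroAdditive) (hoff : OffSharpRankOneAdditive)
    (hP : PublishedInputsAdditiveKoly) (hF : PublishedManinFacts) (hKC : KatoNeronAndCremonaFacts) :
    Summit.BirchSwinnertonDyer.WAllExclAdditiveFiveLeRankOne :=
  closes (kummerCornerTorsionOptimalManinUnit_of_pubBundles hKC hP)
    (supersingularTorsionOptimalManinUnitFive_of_pubBundles hKC hP)
    (ordinaryLowValuationOptimalManinUnitGeEleven_of_katoNeronAndCremonaFacts hKC)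
    principalSeriesOptimalManinUnitOfCells_proof supercuspidalOptimalManinUnitFiveSevenOfCell_proof
    WeilTypeManinGlue.weilTypeManinGlue_proof h₁ h₀ hoff hP hF hKC

end Summit.BirchSwinnertonDyer.BirchSwinnertonDyer.Theorems.TeichmullerTwistDescent

end
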